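import Summits.HubbardSuperconductivity.HubbardSuperconductivity.Theorems.BirComplexStableXY.Negative.WitnessTable
import HarnessLib

/-!
# Crux `BirComplexStableXYR` (stmt-HubbardSuperconductivity-14845), line `fat-gaussian-defect-calculus`:
# stub E4 `stub_berryWeightsReflect` — the Berry weights are odd under the time reflection

Helper (`--supports`) for the crux
`Summit.HubbardSuperconductivity.HubbardSuperconductivity.Theses.BalabanIR.BirComplexStableXYR`, line
`fat-gaussian-defect-calculus` (lead skeleton `Cruxes/BirComplexStableXYR/Lines/fat_gaussian_defect_calculus.lean`),
registered stub E4 `stub_berryWeightsReflect` (wave 8).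

**Statement.** For a window Fourier table `c : Table r` with the time-reflection Hermiticity (R)
`c (n ∘ R) = conj (c (−n))`, `R w = (w.1, w.2.1, rev w.2.2)`, the Berry weights
`m_w := Σ_n Re(c_n) · n_w` (hypothesis `hm`, `m w = c.sum (fun n a => a.re * n w)`) satisfy
`m (R w) = − m w` for every window site `w`.

**Proof.** `m (R w) = Σ_{n ∈ supp c} Re(c_n) · n (R w)`.  Re-index the support by the involution
`ι n := −(n ∘ R)` (`R ∘ R = id`, `Fin.rev_rev`): (R) at `−n` reads `c (ι n) = conj (c n)`
(`hsc_berryReflect_table_iota`), so `ι` preserves the support, `Re c (ι n) = Re c n` (`Complex.conj_re`) and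
`(ι n) (R w) = −n w`; `Finset.sum_nbij'` then gives `m (R w) = Σ_n Re(c_n) · (−n w) = −m w`
(`hsc_berryReflect_sum`).  Elementary `Finsupp` bookkeeping; no definitions; sorry-free; Mathlib only. [folklore]
-/

set_option linter.dupNamespace false -- `Summit.<S>.<S>.Theorems…` repeats the summit name (D-0017 layout)

noncomputable section

namespace Summit.HubbardSuperconductivity.HubbardSuperconductivity.Theorems.FSUnfolding

open scoped BigOperators ComplexConjugate
open Literature.Probability.LatticeModels
open Summit.HubbardSuperconductivity.BirComplexStableXYNegative

/-- (R) rewritten for the frequency involution `ι n := −(n ∘ R)`: `c (ι n) = conj (c n)`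
((R) applied to `−n`, `−(−n) = n`). [folklore] -/
theorem hsc_berryReflect_table_iota {r : ℕ} (c : Table r)
    (hR : ∀ n : Freq r, c (fun w => n (w.1, w.2.1, Fin.rev w.2.2)) = conj (c (-n)))
    (n : Freq r) :
    c (fun w => -n (w.1, w.2.1, Fin.rev w.2.2)) = conj (c n) := by
  have h := hR (-n)
  simp only [Pi.neg_apply, neg_neg] at h
  exact h

/-- **The Berry-weight sum is (R)-odd on the support**:
`Σ_{n ∈ supp c} Re(c_n) · n (R w) = − Σ_{n ∈ supp c} Re(c_n) · n w`, by re-indexing the support with the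
involution `ι n := −(n ∘ R)` (`Finset.sum_nbij'`; `c (ι n) = conj (c n)` preserves the support and the real
part, and `(ι n) (R w) = −n w` by `Fin.rev_rev`). [folklore] -/
theorem hsc_berryReflect_sum {r : ℕ} (c : Table r)
    (hR : ∀ n : Freq r, c (fun w => n (w.1, w.2.1, Fin.rev w.2.2)) = conj (c (-n)))
    (w : W r) :
    ∑ n ∈ c.support, (c n).re * ((n (w.1, w.2.1, Fin.rev w.2.2) : ℤ) : ℝ) =
      -∑ n ∈ c.support, (c n).re * ((n w : ℤ) : ℝ) := by
  classical
  have hkey : ∀ n : Freq r, c (fun w' => -n (w'.1, w'.2.1, Fin.rev w'.2.2)) = conj (c n) :=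
    fun n => hsc_berryReflect_table_iota c hR n
  have hmem : ∀ n ∈ c.support, (fun w' => -n (w'.1, w'.2.1, Fin.rev w'.2.2)) ∈ c.support := by
    intro n hn
    rw [Finsupp.mem_support_iff] at hn ⊢
    rw [hkey n]
    exact fun h => hn (by simpa using congrArg conj h)
  have hinvol : ∀ n : Freq r,
      (fun w' : W r => -(fun w'' : W r => -n (w''.1, w''.2.1, Fin.rev w''.2.2))
        (w'.1, w'.2.1, Fin.rev w'.2.2)) = n := by
    intro n
    funext w'
    simp [Fin.rev_rev]
  rw [← Finset.sum_neg_distrib]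
  symm
  refine Finset.sum_nbij' (fun n => fun w' => -n (w'.1, w'.2.1, Fin.rev w'.2.2))
    (fun n => fun w' => -n (w'.1, w'.2.1, Fin.rev w'.2.2)) hmem hmem
    (fun n _ => hinvol n) (fun n _ => hinvol n) ?_
  intro n _
  rw [hkey n, Complex.conj_re]
  simp only [Fin.rev_rev, Int.cast_neg]
  ring

/-- **Stub E4 `stub_berryWeightsReflect` (registered signature, verbatim): the Berry weights are odd under the
time reflection.**  With `m_w = Σ_n Re(c_n) n_w` (hypothesis `hm`), hypothesis (R)
(`c_{n∘R} = conj c_{−n}`, `R(a,b,t) = (a,b,r−1−t)`) gives `m_{Rw} = −m_w`: unfold `m` by `hm` on both sides,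
`Finsupp.sum` is the sum over the support, and apply `hsc_berryReflect_sum` (re-index the table sum by the
support-preserving involution `n ↦ −(n∘R)`, under which `Re c` is even and `n_{Rw}` turns into `−n_w`). [folklore] -/
theorem stub_berryWeightsReflect :
    ∀ (r : ℕ) (c : Table r),
      (∀ n : Freq r, c (fun w => n (w.1, w.2.1, Fin.rev w.2.2)) = (starRingEnd ℂ) (c (-n))) →
      ∀ (m : W r → ℝ), (∀ w : W r, m w = c.sum (fun n a => a.re * (n w : ℝ))) →
      ∀ w : W r, m (w.1, w.2.1, Fin.rev w.2.2) = -m w := by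
  intro r c hR m hm w
  rw [hm (w.1, w.2.1, Fin.rev w.2.2), hm w]
  unfold Finsupp.sum
  exact hsc_berryReflect_sum c hR w

end Summit.HubbardSuperconductivity.HubbardSuperconductivity.Theorems.FSUnfolding

end
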